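import Summits.Ventures.PercRepro.Night2ThreeTwoTopCaps
import Summits.Ventures.PercRepro.Night2ThreeTwoFiberAll

/-!
# PercRepro — the cell `(3, 2)`: the basis pairs' inequality from a count of the lossy covering bases
(night-2, gen 27)

The small obstruction cells (`9 ≤ |V| ≤ 10`) are paid by the TOP levels alone: at a target with `|T ∖ K| ≥ n − 1`
the capacity `cap3` is `1`, at `|T ∖ K| = n − 2` it is at least `1 − 3/20 − C(n − 2, 2)/198`
(`Night2ThreeTwoTopCaps`), and the non-`P` mass of a target is at most `cnt (i, j) · E/D` for a count function of the
profile `(i, j) = (|T′ ∩ X|, |T′ ∖ X|)` along a set `X ⊆ V` (the line count along a long line, or the number of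
`4`-subsets with three points on the fat plane).  Grouping the targets by profile (at least
`C(|X| − i₀, i − i₀) · C(|V ∖ X| − j₀, j − j₀)` of each, `Night2ThreeTwoFiberAll`) gives the income
`≥ D · qSumC`, so the fair-share inequality holds as soon as `1 ≤ qSumC`.

* `topFloor n s`: the capacity floor of a target of size `s` — `1` at `s ≥ n − 1`, `1 − 3/20 − C(n−2, 2)/198` at
  `s = n − 2`, else `0`;
* `qSumC L y i₀ j₀ n E cnt`: the count sum;
* **`basis_pair_fair_of_qSumC`**: (ii) at a basis pair from `1 ≤ qSumC` and a per-target mass bound `cnt · E/D`;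
* the kernel facts at `|V| = 9, 10` (section `SmallSums`): Case I (a line `L` with `λ ≥ n − 3` points, the pair's
  basis with `t` points on it, `cnt = lineCount`) at `(n, λ, t) ∈ {(9, 6, 1), (9, 6, 2), (9, 7, 2), (10, 7, 1),
  (10, 7, 2), (10, 8, 2)}`, and Case II (the fat plane `P₀` with `n − 2` points, the pair of profile `(3, 1)`,
  `cnt i j = j · C(i, 3)` = `planeCount`) at `n ∈ {9, 10}` — the sums are `1.14 … 3.1`.
-/

namespace PercRepro.Shadow

open Finset PerFlat ThmH

variable {α : Type*} [DecidableEq α] {M : Matroid α} [M.Finite]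

/-- The capacity floor of a target with `s` points off the coloops in a flat with `n`: the top two levels only. -/
def topFloor (n s : ℕ) : ℚ :=
  if n ≤ s + 1 then 1 else if s + 2 = n then 1 - 3 / 20 - (((n - 2).choose 2 : ℕ) : ℚ) / 198 else 0

/-- The count sum of a basis pair of profile `(i₀, j₀)` along a set with `L` points and `y` points off it: over the
profiles `(i, j)` of its targets (`i ≥ i₀`, `j ≥ j₀`, `(i, j) ≠ (i₀, j₀)`), the number of targets of that profile
times the floor over `cnt i j · E`. -/
def qSumC (L y i₀ j₀ n : ℕ) (E : ℚ) (cnt : ℕ → ℕ → ℕ) : ℚ :=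
  ∑ i ∈ Finset.range (L + 1), ∑ j ∈ Finset.range (y + 1),
    if i₀ ≤ i ∧ j₀ ≤ j ∧ (i, j) ≠ (i₀, j₀) then
      ((L - i₀).choose (i - i₀) * (y - j₀).choose (j - j₀) : ℚ) * (topFloor n (i + j) / ((cnt i j : ℚ) * E))
    else 0

omit [DecidableEq α] [M.Finite] in
/-- Floors are nonnegative (for `n ≤ 20`, where `3/20 + C(n − 2, 2)/198 ≤ 1`). -/
theorem topFloor_nonneg (n s : ℕ) (hn : n ≤ 20) : 0 ≤ topFloor n s := by
  unfold topFloor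
  split_ifs with h1 h2
  · norm_num
  · have h3 : (n - 2).choose 2 ≤ 153 := by
      have := Nat.choose_le_choose 2 (show n - 2 ≤ 18 by omega)
      have h18 : Nat.choose 18 2 = 153 := by rw [Nat.choose_two_right]
      omega
    have h3' : (((n - 2).choose 2 : ℕ) : ℚ) ≤ 153 := by exact_mod_cast h3
    linarith
  · exact le_refl _

section CountAssembly

variable {G : Finset α}

open scoped Classical in
/-- **THE BASIS PAIRS' INEQUALITY FROM A COUNT SUM** (cell `(3, 2)`, `|V| ≥ 8`, `P` = the big members): for a lossy
basis pair `(B, z)`, if the non-`P` mass of every target `T` is at most `cnt (i, j) · E/D` in terms of its profile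
`(i, j)` along `X ⊆ V` (`E = (n + 56)/(20 n)`, `D = 2^{n−4} − 1`) and `1 ≤ qSumC |X| |V ∖ X| i₀ j₀ n E cnt` for the
profile `(i₀, j₀)` of `B ∪ {z}`, then `loss B z ≤ rhoL B z · lossIncomeH B z`. -/
theorem basis_pair_fair_of_qSumC (hG : G ∈ flatsQ M (5 + 1)) (hd : (gr M \ G).card = 3) (hk : kColoops M G = 2)
    (hs : ∀ e ∈ gr M, ∀ f ∈ gr M, e ≠ f → rkN M {e, f} = 2) (hl : ∀ e ∈ gr M, M.Indep {e})
    (h8 : 8 ≤ (G \ coloops M G).card) (h20 : (G \ coloops M G).card ≤ 20) {X : Finset α}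
    (hXV : X ⊆ G \ coloops M G) {cnt : ℕ → ℕ → ℕ}
    {B : Finset α} (hB : B ∈ thinMembers M 5 G) (hnP : ¬ BigMember M G B) {z : α} (hz : z ∈ G \ clF M B)
    (hl0 : loss M 5 G B z ≠ 0)
    (hcnt : ∀ T ∈ tgtSets M 5 G B z, pi2MassH M 5 G (BigMember M G) T ≤
      ((cnt (profileAt (coloops M G) X T).1 (profileAt (coloops M G) X T).2 : ℕ) : ℚ) *
        ((((G \ coloops M G).card : ℚ) + 56) / (20 * ((G \ coloops M G).card : ℚ)) /
          ((2 ^ ((G \ coloops M G).card - 4) - 1 : ℕ) : ℚ)))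
    (hsum : 1 ≤ qSumC X.card ((G \ coloops M G) \ X).card (profileAt (coloops M G) X (insert z B)).1
      (profileAt (coloops M G) X (insert z B)).2 (G \ coloops M G).card
      ((((G \ coloops M G).card : ℚ) + 56) / (20 * ((G \ coloops M G).card : ℚ))) cnt) :
    loss M 5 G B z ≤ rhoL M 5 G B z * lossIncomeH M 5 G (BigMember M G) (dshMissed M 5 G) B z := by
  have hd' : (gr M \ G).card ≤ 5 := by omega
  have hk' : kColoops M G + 4 = 5 + 1 := by omega
  have hP' : ∀ B, BigMember M G B → 4 ≤ (B \ coloops M G).card := fun B h => h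
  have hB' : B ∈ membersIn M (Uq M (5 + 2) 5) G := (mem_thinMembers.1 hB).1
  have hKG : coloops M G ⊆ G := fun y hy => (mem_coloops.1 hy).1
  have hKB : coloops M G ⊆ B := coloops_subset_of_mem_thinMembers hG hd' hB
  have hB3 : (B \ coloops M G).card + 1 = 4 := by
    have := card_sdiff_coloops_thin_ge hG hd' hk' hB
    unfold BigMember at hnP
    omega
  set n := (G \ coloops M G).card with hn
  have hGn : G.card - kColoops M G = n := by
    rw [hn, Finset.card_sdiff_of_subset hKG, kColoops_eq_card_coloops]
  have hr : (G \ insert z B).card = n - 4 := by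
    rw [card_sdiff_insert_eq_dqm1 hG hd' hB hB3 hz, hGn]
  set E : ℚ := ((n : ℚ) + 56) / (20 * (n : ℚ)) with hE
  set D : ℚ := ((2 ^ (n - 4) - 1 : ℕ) : ℚ) with hD
  have hDpos : 0 < D := by
    rw [hD]
    have : 2 ≤ 2 ^ (n - 4) := by
      calc 2 = 2 ^ 1 := by norm_num
        _ ≤ 2 ^ (n - 4) := Nat.pow_le_pow_right (by norm_num) (by omega)
    exact_mod_cast (by omega : 0 < 2 ^ (n - 4) - 1)
  have hEpos : 0 < E := by
    rw [hE]
    have : (8 : ℚ) ≤ (n : ℚ) := by exact_mod_cast h8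
    positivity
  have hT : ((tgtSets M 5 G B z).card : ℚ) = D := by
    rw [card_tgtSets hG hB' hz, hr]
  have hrho : rhoL M 5 G B z = loss M 5 G B z / D := by
    unfold rhoL; rw [hT]
  have hdl : ∀ S ∈ shadowAt M (5 + 2) 5 (Uq M (5 + 2) 5) G,
      dload M 5 G (BigMember M G) (dshMissed M 5 G) S ≤ cap2 M 5 G S :=
    fun S _ => dload_missed_le_cap2_three_two hG hd hk hs hl hP' S
  -- the targets, their profiles, the bounds
  set 𝒯 := tgtSets M 5 G B z with h𝒯def
  have hTsh : ∀ T ∈ 𝒯, T ∈ shadowAt M (5 + 2) 5 (Uq M (5 + 2) 5) G := fun T hT => (mem_tgtSets.1 hT).1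
  have hprof : ∀ T ∈ 𝒯, (profileAt (coloops M G) X T).1 + (profileAt (coloops M G) X T).2 =
      (T \ coloops M G).card := by
    intro T _
    simp only [profileAt]
    rw [add_comm, Finset.card_sdiff_add_card_inter]
  -- the bounds `u`, `v`
  set u : Finset α → ℚ := fun T =>
    ((cnt (profileAt (coloops M G) X T).1 (profileAt (coloops M G) X T).2 : ℕ) : ℚ) * (E / D) with hu_def
  set v : Finset α → ℚ := fun T => topFloor n (T \ coloops M G).card with hv_def
  have hu : ∀ T ∈ 𝒯, pi2MassH M 5 G (BigMember M G) T ≤ u T := fun T hT => hcnt T hT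
  have hv : ∀ T ∈ 𝒯, v T ≤ cap3 M 5 G (BigMember M G) (dshMissed M 5 G) T := by
    intro T hT
    simp only [hv_def, topFloor]
    split_ifs with h1 h2
    · exact one_le_cap3_of_top hG hd hk hs hl hP' (hTsh T hT) h1
    · exact cap3_ge_of_second hG hd hk hs hl h8 hP' (hTsh T hT) h2
    · exact cap3_nonneg (hdl T (hTsh T hT))
  have hv0 : ∀ T ∈ 𝒯, 0 ≤ v T := fun T _ => topFloor_nonneg n _ h20
  have hinc := lossIncomeH_ge_of_subfamily hG hd' hdl hB hnP hz hl0 (Finset.Subset.refl 𝒯) u v hu hv hv0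
  -- the subfamily sum is `D · Σ_{T ∈ 𝒯} F (profile T)`, `F (i, j) = topFloor n (i + j) / (cnt i j · E)`
  set F : ℕ × ℕ → ℚ := fun p => topFloor n (p.1 + p.2) / ((cnt p.1 p.2 : ℚ) * E) with hF_def
  have hF0 : ∀ p, 0 ≤ F p := fun p => div_nonneg (topFloor_nonneg _ _ h20) (mul_nonneg (by positivity) hEpos.le)
  have hsum1 : ∑ T ∈ 𝒯, v T / u T = D * ∑ T ∈ 𝒯, F (profileAt (coloops M G) X T) := by
    rw [Finset.mul_sum]
    apply Finset.sum_congr rfl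
    intro T hT
    simp only [hu_def, hv_def, hF_def]
    rw [← hprof T hT]
    by_cases hm : (cnt (profileAt (coloops M G) X T).1 (profileAt (coloops M G) X T).2 : ℚ) = 0
    · simp only [hm, zero_mul, div_zero, mul_zero]
    · field_simp
  -- regroup by profile
  set t : Finset (ℕ × ℕ) := (Finset.range (X.card + 1)) ×ˢ (Finset.range (((G \ coloops M G) \ X).card + 1))
    with ht_def
  have hfib : ∑ p ∈ t, ∑ T ∈ 𝒯.filter (fun T => profileAt (coloops M G) X T = p), F (profileAt (coloops M G) X T) ≤
      ∑ T ∈ 𝒯, F (profileAt (coloops M G) X T) := by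
    apply Finset.sum_fiberwise_le_sum_of_sum_fiber_nonneg
    intro p _
    exact Finset.sum_nonneg (fun T _ => hF0 _)
  have hfib' : ∀ p ∈ t, ∑ T ∈ 𝒯.filter (fun T => profileAt (coloops M G) X T = p), F (profileAt (coloops M G) X T) =
      ((𝒯.filter (fun T => profileAt (coloops M G) X T = p)).card : ℚ) * F p := by
    intro p _
    rw [← nsmul_eq_mul, ← Finset.sum_const]
    apply Finset.sum_congr rfl
    intro T hT
    rw [(Finset.mem_filter.1 hT).2]
  -- the count sum as a sum over `t`
  set i₀ := (profileAt (coloops M G) X (insert z B)).1 with hi₀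
  set j₀ := (profileAt (coloops M G) X (insert z B)).2 with hj₀
  have hq : qSumC X.card ((G \ coloops M G) \ X).card i₀ j₀ n E cnt =
      ∑ p ∈ t, if i₀ ≤ p.1 ∧ j₀ ≤ p.2 ∧ p ≠ (i₀, j₀) then
        ((X.card - i₀).choose (p.1 - i₀) * (((G \ coloops M G) \ X).card - j₀).choose (p.2 - j₀) : ℚ) * F p
      else 0 := by
    unfold qSumC
    rw [ht_def, Finset.sum_product]
  have hge : ∀ p ∈ t, (if i₀ ≤ p.1 ∧ j₀ ≤ p.2 ∧ p ≠ (i₀, j₀) then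
        ((X.card - i₀).choose (p.1 - i₀) * (((G \ coloops M G) \ X).card - j₀).choose (p.2 - j₀) : ℚ) * F p
      else 0) ≤ ((𝒯.filter (fun T => profileAt (coloops M G) X T = p)).card : ℚ) * F p := by
    intro p _
    split_ifs with hcond
    · apply mul_le_mul_of_nonneg_right _ (hF0 p)
      obtain ⟨hi, hj, hne⟩ := hcond
      have hne' : (p.1, p.2) ≠ profileAt (coloops M G) X (insert z B) := by
        intro h
        apply hne
        rw [hi₀, hj₀, Prod.mk.eta, ← h, Prod.mk.eta]
      have := card_fiber_ge_choose_mul_choose_all hG hd' hB hz hXV hne' hi hj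
      exact_mod_cast this
    · exact mul_nonneg (by positivity) (hF0 p)
  have hqle : qSumC X.card ((G \ coloops M G) \ X).card i₀ j₀ n E cnt ≤
      ∑ T ∈ 𝒯, F (profileAt (coloops M G) X T) := by
    rw [hq]
    refine le_trans (Finset.sum_le_sum hge) (le_trans (le_of_eq ?_) hfib)
    apply Finset.sum_congr rfl
    intro p hp
    exact (hfib' p hp).symm
  -- assemble
  have hinc' : D ≤ lossIncomeH M 5 G (BigMember M G) (dshMissed M 5 G) B z := by
    calc D = D * 1 := by ring
      _ ≤ D * qSumC X.card ((G \ coloops M G) \ X).card i₀ j₀ n E cnt :=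
          mul_le_mul_of_nonneg_left hsum hDpos.le
      _ ≤ D * ∑ T ∈ 𝒯, F (profileAt (coloops M G) X T) :=
          mul_le_mul_of_nonneg_left hqle hDpos.le
      _ = ∑ T ∈ 𝒯, v T / u T := hsum1.symm
      _ ≤ _ := hinc
  rw [hrho]
  have hl1 : 0 ≤ loss M 5 G B z := loss_nonneg' hG hd' B z
  calc loss M 5 G B z = loss M 5 G B z / D * D := by field_simp
    _ ≤ loss M 5 G B z / D * lossIncomeH M 5 G (BigMember M G) (dshMissed M 5 G) B z :=
        mul_le_mul_of_nonneg_left hinc' (div_nonneg hl1 hDpos.le)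

end CountAssembly

section SmallSums

/-- The count of the `4`-subsets with exactly three points on a plane: `j · C(i, 3)` at the profile `(i, j)`. -/
def planeCount (i j : ℕ) : ℕ := j * i.choose 3

/-- Case I at `n = 9`: a line with `6` points, the basis with `1` points on it. -/
theorem qSumC_line_9_6_1 : 1 ≤ qSumC 6 3 1 3 9 ((((9 : ℕ) : ℚ) + 56) / (20 * ((9 : ℕ) : ℚ))) lineCount := by
  unfold qSumC topFloor lineCount
  simp only [Finset.sum_range_succ, Finset.sum_range_zero]
  norm_num [Nat.choose]

/-- Case I at `n = 9`: a line with `6` points, the basis with `2` points on it. -/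
theorem qSumC_line_9_6_2 : 1 ≤ qSumC 6 3 2 2 9 ((((9 : ℕ) : ℚ) + 56) / (20 * ((9 : ℕ) : ℚ))) lineCount := by
  unfold qSumC topFloor lineCount
  simp only [Finset.sum_range_succ, Finset.sum_range_zero]
  norm_num [Nat.choose]

/-- Case I at `n = 9`: a line with `7` points, the basis with `2` points on it. -/
theorem qSumC_line_9_7_2 : 1 ≤ qSumC 7 2 2 2 9 ((((9 : ℕ) : ℚ) + 56) / (20 * ((9 : ℕ) : ℚ))) lineCount := by
  unfold qSumC topFloor lineCount
  simp only [Finset.sum_range_succ, Finset.sum_range_zero]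
  norm_num [Nat.choose]

/-- Case I at `n = 10`: a line with `7` points, the basis with `1` points on it. -/
theorem qSumC_line_10_7_1 : 1 ≤ qSumC 7 3 1 3 10 ((((10 : ℕ) : ℚ) + 56) / (20 * ((10 : ℕ) : ℚ))) lineCount := by
  unfold qSumC topFloor lineCount
  simp only [Finset.sum_range_succ, Finset.sum_range_zero]
  norm_num [Nat.choose]

/-- Case I at `n = 10`: a line with `7` points, the basis with `2` points on it. -/
theorem qSumC_line_10_7_2 : 1 ≤ qSumC 7 3 2 2 10 ((((10 : ℕ) : ℚ) + 56) / (20 * ((10 : ℕ) : ℚ))) lineCount := by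
  unfold qSumC topFloor lineCount
  simp only [Finset.sum_range_succ, Finset.sum_range_zero]
  norm_num [Nat.choose]

/-- Case I at `n = 10`: a line with `8` points, the basis with `2` points on it. -/
theorem qSumC_line_10_8_2 : 1 ≤ qSumC 8 2 2 2 10 ((((10 : ℕ) : ℚ) + 56) / (20 * ((10 : ℕ) : ℚ))) lineCount := by
  unfold qSumC topFloor lineCount
  simp only [Finset.sum_range_succ, Finset.sum_range_zero]
  norm_num [Nat.choose]

/-- Case II at `n = 9`: the fat plane with `7` points, the basis of profile `(3, 1)`. -/
theorem qSumC_plane_9 : 1 ≤ qSumC 7 2 3 1 9 ((((9 : ℕ) : ℚ) + 56) / (20 * ((9 : ℕ) : ℚ))) planeCount := by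
  unfold qSumC topFloor planeCount
  simp only [Finset.sum_range_succ, Finset.sum_range_zero]
  norm_num [Nat.choose]

/-- Case II at `n = 10`: the fat plane with `8` points, the basis of profile `(3, 1)`. -/
theorem qSumC_plane_10 : 1 ≤ qSumC 8 2 3 1 10 ((((10 : ℕ) : ℚ) + 56) / (20 * ((10 : ℕ) : ℚ))) planeCount := by
  unfold qSumC topFloor planeCount
  simp only [Finset.sum_range_succ, Finset.sum_range_zero]
  norm_num [Nat.choose]

end SmallSums

end PercRepro.Shadow
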